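import Mathlib

/-!
# TropicalLinks / InductiveStep — the projective chart subalgebras are Noetherian with fraction field `K`

Route `ResolutionOfSingularities/TropicalLinks`, crux `InductiveStep` (stmt-ResolutionOfSingularities-17233),
line `split`, brick FR (producer brick for `stub_valuativeCharts`).

Setting: `k` a field, `B` a domain which is a `k`-algebra generated by `f₁ … f_n` (the evaluation map
`k[X₁ … X_n] → B` at `f` is surjective), `K = Frac B`.  Put `f' := Fin.cons 1 f : Fin (n+1) → B`, the
homogeneous coordinates of the projective closure `Ȳ ⊆ ℙⁿ` of `Spec B`.  For an index `h` with
`f'_h ≠ 0` the chart subalgebra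
`𝒞_h := k[f'_j / f'_h : j] ⊆ K`
is the coordinate ring of the affine chart `Ȳ ∩ D₊(X_h)`.

* `tropicalLinks_projChart_mul_inv_pow_mem` — every `b ∈ B` satisfies `b · (1/f'_h)^D ∈ 𝒞_h` for some
  `D` (induction on a polynomial presentation of `b`; `1/f'_h = f'_0/f'_h` is a generator of `𝒞_h`).
* `tropicalLinks_projChart_isNoetherianRing_isFractionRing` — **`𝒞_h` is Noetherian, of finite type
  over `k`, and `K` is its field of fractions.**  Finite type: `𝒞_h` is generated by the finite family
  `f'_j / f'_h`; Noetherian: Hilbert's basis theorem; fraction field: every `z ∈ K` is `a / b` with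
  `a, b ∈ B`, and `a / b = (a u^{D₁} u^{D₂}) / (b u^{D₂} u^{D₁})` with `u = 1/f'_h ∈ 𝒞_h`, both
  numerator and denominator lying in `𝒞_h` by the first lemma.
-/

-- single-problem summit: the doubled namespace component `ResolutionOfSingularities` is forced
set_option linter.dupNamespace false

namespace Summit.ResolutionOfSingularities.ResolutionOfSingularities.Theorems

/-- **Clearing denominators into the chart.** With `f' = Fin.cons 1 f` and `u = (f'_h)⁻¹ ∈ K`, every
element `b` of `B = k[f]` satisfies `b · u ^ D ∈ k[f'_j · u : j]` for some `D : ℕ`: constants need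
`D = 0`, a product `p · X_j` bumps `D` by one using the generator `f_j · u = f'_{j+1} · u`, and a sum
uses the generator `u = f'_0 · u` to bring both summands to a common exponent. [folklore] -/
theorem tropicalLinks_projChart_mul_inv_pow_mem
    (k : Type) [Field k] (B : Type) [CommRing B] [Algebra k B] (K : Type) [Field K]
    [Algebra B K] [Algebra k K] [IsScalarTower k B K] (n : ℕ) (f : Fin n → B)
    (hf : Function.Surjective (MvPolynomial.aeval f : MvPolynomial (Fin n) k →ₐ[k] B))
    (h : Fin (n + 1)) (b : B) :
    ∃ D : ℕ, algebraMap B K b * ((algebraMap B K ((Fin.cons (1 : B) f : Fin (n + 1) → B) h))⁻¹) ^ D ∈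
      Algebra.adjoin k (Set.range fun j : Fin (n + 1) =>
        algebraMap B K ((Fin.cons (1 : B) f : Fin (n + 1) → B) j) *
          (algebraMap B K ((Fin.cons (1 : B) f : Fin (n + 1) → B) h))⁻¹) := by
  set u : K := (algebraMap B K ((Fin.cons (1 : B) f : Fin (n + 1) → B) h))⁻¹ with hu
  set S : Subalgebra k K := Algebra.adjoin k (Set.range fun j : Fin (n + 1) =>
    algebraMap B K ((Fin.cons (1 : B) f : Fin (n + 1) → B) j) * u) with hS
  -- the generators `u = f'_0 · u` and `f_j · u = f'_{j+1} · u`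
  have huS : u ∈ S := by
    have hmem := Algebra.subset_adjoin (R := k)
      (s := Set.range fun j : Fin (n + 1) => algebraMap B K ((Fin.cons (1 : B) f : Fin (n + 1) → B) j) * u)
      ⟨0, rfl⟩
    simpa using hmem
  have hfS : ∀ j : Fin n, algebraMap B K (f j) * u ∈ S := fun j => by
    have hmem := Algebra.subset_adjoin (R := k)
      (s := Set.range fun j : Fin (n + 1) => algebraMap B K ((Fin.cons (1 : B) f : Fin (n + 1) → B) j) * u)
      ⟨j.succ, rfl⟩
    simpa using hmem
  obtain ⟨p, rfl⟩ := hf b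
  induction p using MvPolynomial.induction_on with
  | C c =>
    refine ⟨0, ?_⟩
    rw [pow_zero, mul_one, MvPolynomial.aeval_C, ← IsScalarTower.algebraMap_apply]
    exact S.algebraMap_mem c
  | add p q hp hq =>
    obtain ⟨D₁, h₁⟩ := hp
    obtain ⟨D₂, h₂⟩ := hq
    refine ⟨D₁ + D₂, ?_⟩
    rw [map_add, map_add, add_mul]
    refine add_mem ?_ ?_
    · rw [pow_add, ← mul_assoc]
      exact mul_mem h₁ (pow_mem huS _)
    · rw [add_comm D₁, pow_add, ← mul_assoc]
      exact mul_mem h₂ (pow_mem huS _)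
  | mul_X p j hp =>
    obtain ⟨D, hD⟩ := hp
    refine ⟨D + 1, ?_⟩
    rw [map_mul, map_mul, MvPolynomial.aeval_X, pow_succ,
      mul_mul_mul_comm (algebraMap B K (MvPolynomial.aeval f p))]
    exact mul_mem hD (hfS j)

/-- **The chart subalgebras of the projective closure are Noetherian, of finite type, with fraction
field `K`.** For a field `k`, a domain `B = k[f₁ … f_n]` with fraction field `K`, `f' = Fin.cons 1 f`
and an index `h` with `f'_h ≠ 0`, the subalgebra `𝒞_h = k[f'_j / f'_h : j] ⊆ K` is of finite type over
`k` (finitely many generators), hence Noetherian (Hilbert), and `K = Frac 𝒞_h`: every `z ∈ K` is a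
quotient `a / b` of elements of `B`, and multiplying numerator and denominator by a suitable power of
the generator `1 / f'_h ∈ 𝒞_h` puts both into `𝒞_h`. [folklore] -/
theorem tropicalLinks_projChart_isNoetherianRing_isFractionRing : ∀ (k : Type) [Field k] (B : Type) [CommRing B] [IsDomain B] [Algebra k B] (K : Type) [Field K] [Algebra B K] [IsFractionRing B K] [Algebra k K] [IsScalarTower k B K] (n : ℕ) (f : Fin n → B), Function.Surjective (MvPolynomial.aeval f : MvPolynomial (Fin n) k →ₐ[k] B) → ∀ (h : Fin (n + 1)), (Fin.cons (1 : B) f : Fin (n + 1) → B) h ≠ 0 → IsNoetherianRing ↥(Algebra.adjoin k (Set.range fun j : Fin (n + 1) => algebraMap B K ((Fin.cons (1 : B) f : Fin (n + 1) → B) j) * (algebraMap B K ((Fin.cons (1 : B) f : Fin (n + 1) → B) h))⁻¹)) ∧ IsFractionRing ↥(Algebra.adjoin k (Set.range fun j : Fin (n + 1) => algebraMap B K ((Fin.cons (1 : B) f : Fin (n + 1) → B) j) * (algebraMap B K ((Fin.cons (1 : B) f : Fin (n + 1) → B) h))⁻¹)) K ∧ Algebra.FiniteType k ↥(Algebra.adjoin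 k (Set.range fun j : Fin (n + 1) => algebraMap B K ((Fin.cons (1 : B) f : Fin (n + 1) → B) j) * (algebraMap B K ((Fin.cons (1 : B) f : Fin (n + 1) → B) h))⁻¹)) := by
  intro k _ B _ _ _ K _ _ _ _ _ n f hf h hh
  set u : K := (algebraMap B K ((Fin.cons (1 : B) f : Fin (n + 1) → B) h))⁻¹ with hu
  set S : Subalgebra k K := Algebra.adjoin k (Set.range fun j : Fin (n + 1) =>
    algebraMap B K ((Fin.cons (1 : B) f : Fin (n + 1) → B) j) * u) with hS
  -- finite type (finitely many generators), hence Noetherian over the field `k`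
  haveI hFT : Algebra.FiniteType k S := Algebra.FiniteType.adjoin_of_finite (Set.finite_range _)
  refine ⟨Algebra.FiniteType.isNoetherianRing k S, ?_, hFT⟩
  -- fraction field: `u ∈ S`, `u ≠ 0`, and `B · u^D ⊆ S` elementwise
  have huS : u ∈ S := by
    have hmem := Algebra.subset_adjoin (R := k)
      (s := Set.range fun j : Fin (n + 1) => algebraMap B K ((Fin.cons (1 : B) f : Fin (n + 1) → B) j) * u)
      ⟨0, rfl⟩
    simpa using hmem
  have hu0 : u ≠ 0 := inv_ne_zero ((map_ne_zero_iff _ (IsFractionRing.injective B K)).mpr hh)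
  refine IsFractionRing.of_field S K fun z => ?_
  obtain ⟨a, b, -, rfl⟩ := IsFractionRing.div_surjective (A := B) z
  obtain ⟨D₁, h₁⟩ := tropicalLinks_projChart_mul_inv_pow_mem k B K n f hf h a
  obtain ⟨D₂, h₂⟩ := tropicalLinks_projChart_mul_inv_pow_mem k B K n f hf h b
  refine ⟨⟨_, mul_mem h₁ (pow_mem huS D₂)⟩, ⟨_, mul_mem h₂ (pow_mem huS D₁)⟩, ?_⟩
  change _ = algebraMap B K a * u ^ D₁ * u ^ D₂ / (algebraMap B K b * u ^ D₂ * u ^ D₁)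
  rw [mul_assoc, mul_assoc, ← pow_add, ← pow_add, add_comm D₂ D₁,
    mul_div_mul_right _ _ (pow_ne_zero _ hu0)]

end Summit.ResolutionOfSingularities.ResolutionOfSingularities.Theorems
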